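import Mathlib
import Summits.PneNP.PneNP.Theorems.ConvexRankGatesConvexGateBlindExactLiftingCharacters
import Summits.PneNP.PneNP.Theorems.ConvexRankGatesConvexGateBlindExactLiftingCalibration

/-!
# PneNP / ConvexRankGates — `ConvexGateBlind`, line `xor-door-perfect-completeness`:
# the K₄ test instance of `stub_exactLifting` (lead c4)

Registered sub-goal `exactLifting_phi_three_le_five` of crux item stmt-PneNP-10680 (line
`xor-door-perfect-completeness`, open stub `stub_exactLifting : XorDoor.ExactLifting`).

The odd-charge Tseitin system `K4` of the complete graph `K₄` (6 edge variables, 4 vertex equations,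
`viol_{K4} ∈ {1,3}`) is the minimal legitimate instance of the hypothesis of `ExactLifting` (`d = 3`;
`d ≤ 2` perfect pseudo-expectations are degenerate; leads c2/c3 named it the test instance).  This file
makes it an instance OF RECORD:

* §1 `K4`, the explicit count `violN = viol K4` (`viol_K4_eq`), `k4_viol_pos` / `k4_unsat` (parity),
  `k4_card` (`#{viol ≥ 2} = 32`) and `k4_noSubcube`: `{viol ≥ 2}` contains NO subcube of codimension
  `< 5` (two free edges always allow a completion with a single bad vertex, `k4_escape`) — the input of
  the unit-level lower bound `32 t⁵ ≤ 6⁶ · rk₊(lift_t(viol_{K4}) − J)` of `…ExactLiftingK4Inst.lean`.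
  The finite facts are kernel-decided on `violN`.
* §2 `K4PE.hasPerfectPseudoExp : HasPerfectPseudoExp 3 K4` — Grigoriev's functional by hand:
  `E[h] = 2^{-6} Σ_y ẽ(y) h(y)` with density `ẽ = 1 − χ_{T₁} + χ_{T₂} + χ_{T₃} + χ_{T₄}` (`T_v` the star
  of vertex `v`, sign = charge); `E[1] = 1` and `E[viol] = 0` are kernel-decided integer sums
  (`sum_densZ`, `sum_densZ_violN`); non-negativity on non-negative `3`-juntas because a character of
  a `3`-set is orthogonal to every junta on another `≤ 3`-set and at most one star lies inside the
  junta's support (`E_junta_nonneg`); the SOS clause from `sum_chi_mul_sq_eq_zero` of the Characters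
  toolkit (`E_sq_nonneg`).  With `k4_unsat`: an explicit witness of `PerfectCompleteness` at `d = 3`
  (`k4_perfectCompleteness_three`).
* §3 `k4_sa_five` — the degree-5 Sherali–Adams value of `K4` is `1` (maximal): `viol − 1 = 2·j₁ + 2·j₂`
  with `j₁ = [s₁ = s₂ = 1]`, `j₂ = [s₃ = 1, s₁ ≠ s₂]` non-negative `5`-juntas in the vertex parities
  (`violN_eq`, kernel-decided); hence (c1's `hasConeFact_shift_of_saValue`) `k4_unitLevel_upper`: the
  unit-potential level `lift_t(viol_{K4}) − J` factorises with `r ≤ #{S ⊆ [6] : #S ≤ 5} · (2t)⁵`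
  non-negative terms (the matching lower bound `Ω(t⁵)` is `…ExactLiftingK4Inst.lean`), and
  `exactLifting_phi_three_le_five` (registered): by c1's `exactLifting_exponent_le` every exponent
  function of `ExactLifting` has `φ(3) ≤ 5` — the LP window of the stub at `d = 3` is `[rank corner, 5]`.

Defined here (file-local): `K4`, `violN`, `K4PE.star/sgn/chiZ/densZ/chi/dens/E`, `j₁`, `j₂`.
-/

set_option linter.dupNamespace false -- `Summit.PneNP.PneNP.…`: summit = sub-problem (D-0017)

namespace Summit.PneNP.PneNP.Theorems.XorDoor

open scoped BigOperators
open Finset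

noncomputable section

namespace K4Inst

/-! ## §1 The K₄ system and its kernel-decided finite facts -/

/-- The odd-charge Tseitin system of `K₄`: edge variables `0,…,5` (vertex 1: edges `0,1,2`; vertex 2:
`0,3,4`; vertex 3: `1,3,5`; vertex 4: `2,4,5`), charge `1` at vertex 1 and `0` elsewhere. -/
def K4 : Finset (Pool 6) := {(0, 1, 2, 1), (0, 3, 4, 0), (1, 3, 5, 0), (2, 4, 5, 0)}

/-- The explicit violation count of `K4` (number of vertex equations violated). -/
def violN (z : Fin 6 → ZMod 2) : ℕ :=
  (if z 0 + z 1 + z 2 = 1 then 0 else 1) + (if z 0 + z 3 + z 4 = 0 then 0 else 1)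
    + (if z 1 + z 3 + z 5 = 0 then 0 else 1) + (if z 2 + z 4 + z 5 = 0 then 0 else 1)

/-- `viol K4` is the explicit 4-term count `violN`. -/
theorem viol_K4_eq (z : Fin 6 → ZMod 2) : viol K4 z = violN z := by
  classical
  unfold viol K4 violN
  rw [Finset.filter_insert, Finset.filter_insert, Finset.filter_insert, Finset.filter_singleton]
  simp only [Sat]
  by_cases h1 : z 0 + z 1 + z 2 = 1 <;> by_cases h2 : z 0 + z 3 + z 4 = 0 <;>
    by_cases h3 : z 1 + z 3 + z 5 = 0 <;> by_cases h4 : z 2 + z 4 + z 5 = 0 <;>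
    simp [h1, h2, h3, h4]

/-- Parity: every assignment violates at least one vertex equation of `K4` (in fact `1` or `3`). -/
theorem k4_viol_pos (z : Fin 6 → ZMod 2) : 1 ≤ viol K4 z := by
  rw [viol_K4_eq]
  have key : ∀ a0 a1 a2 a3 a4 a5 : ZMod 2, 1 ≤ violN ![a0, a1, a2, a3, a4, a5] := by decide
  have hz : z = ![z 0, z 1, z 2, z 3, z 4, z 5] := by
    funext k; fin_cases k <;> rfl
  rw [hz]; exact key _ _ _ _ _ _

/-- `K4` is unsatisfiable. -/
theorem k4_unsat : ¬ ∃ y : Fin 6 → ZMod 2, ∀ e ∈ K4, Sat y e := by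
  classical
  rintro ⟨y, hy⟩
  have h0 : viol K4 y = 0 := by
    unfold viol
    rw [Finset.card_eq_zero, Finset.filter_eq_empty_iff]
    intro e he h; exact h (hy e he)
  have := k4_viol_pos y
  omega

/-- `{viol_{K4} ≥ 2}` has exactly `32` of the `64` points. -/
theorem k4_card : (univ.filter fun z : Fin 6 → ZMod 2 => 2 ≤ viol K4 z).card = 32 := by
  classical
  have h : (univ.filter fun z : Fin 6 → ZMod 2 => 2 ≤ viol K4 z)
      = univ.filter fun z : Fin 6 → ZMod 2 => 2 ≤ violN z := by
    refine Finset.filter_congr fun z _ => ?_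
    rw [viol_K4_eq]
  rw [h]
  decide

/-- Two free edges always allow a completion with at most one bad vertex (kernel-decided on `violN`). -/
theorem k4_escape (z₀ : Fin 6 → ZMod 2) {i j : Fin 6} (hij : i ≠ j) :
    ∃ b b' : ZMod 2, violN (Function.update (Function.update z₀ i b) j b') ≤ 1 := by
  have key : ∀ a0 a1 a2 a3 a4 a5 : ZMod 2, ∀ i j : Fin 6, i ≠ j → ∃ b b' : ZMod 2,
      violN (Function.update (Function.update ![a0, a1, a2, a3, a4, a5] i b) j b') ≤ 1 := by
    decide
  have hz : z₀ = ![z₀ 0, z₀ 1, z₀ 2, z₀ 3, z₀ 4, z₀ 5] := by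
    funext k; fin_cases k <;> rfl
  rw [hz]; exact key _ _ _ _ _ _ i j hij

/-- `{viol_{K4} ≥ 2}` contains no subcube of codimension `< 5`: the local certificate complexity of
"at least two bad vertices" is `5` (the two stars of an adjacent pair of vertices) at every point. -/
theorem k4_noSubcube : ∀ S : Finset (Fin 6), S.card < 5 → ∀ z₀ : Fin 6 → ZMod 2,
    ∃ z : Fin 6 → ZMod 2, (∀ i ∈ S, z i = z₀ i) ∧ z ∉ {z : Fin 6 → ZMod 2 | 2 ≤ viol K4 z} := by
  classical
  intro S hS z₀
  -- two distinct free coordinates outside `S`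
  have hc : 1 < (univ \ S).card := by
    rw [Finset.card_sdiff_of_subset (Finset.subset_univ _), Finset.card_univ, Fintype.card_fin]; omega
  obtain ⟨i, hi, j, hj, hij⟩ := Finset.one_lt_card.1 hc
  simp only [Finset.mem_sdiff, Finset.mem_univ, true_and] at hi hj
  obtain ⟨b, b', hbb⟩ := k4_escape z₀ hij
  refine ⟨Function.update (Function.update z₀ i b) j b', fun k hk => ?_, ?_⟩
  · have hki : k ≠ i := fun h => hi (h ▸ hk)
    have hkj : k ≠ j := fun h => hj (h ▸ hk)
    simp [Function.update_of_ne hkj, Function.update_of_ne hki]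
  · simp only [Set.mem_setOf_eq, not_le, viol_K4_eq]
    omega

end K4Inst

namespace K4PE

/-! ## §2 Grigoriev's degree-3 functional for `K4` -/

/-- The four stars of `K₄` in the edge numbering of `K4` (vertex `v+1` ↦ its three edges). -/
def star : Fin 4 → Finset (Fin 6) := ![{0, 1, 2}, {0, 3, 4}, {1, 3, 5}, {2, 4, 5}]

/-- The signs `(-1)^{charge}`: charge `1` at the first vertex, `0` elsewhere. -/
def sgn : Fin 4 → ℤ := ![-1, 1, 1, 1]

/-- Integer-valued `±1` character of `T`. -/
def chiZ (T : Finset (Fin 6)) (y : Fin 6 → ZMod 2) : ℤ := if ∑ l ∈ T, y l = 0 then 1 else -1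

/-- Integer density `ẽ = 1 + Σ_v sgn_v χ_{T_v}` of the functional (values in `{-3,…,5}`). -/
def densZ (y : Fin 6 → ZMod 2) : ℤ := 1 + ∑ v : Fin 4, sgn v * chiZ (star v) y

/-- Real `±1` character of `T` (the expression used by the Characters toolkit). -/
def chi (T : Finset (Fin 6)) (y : Fin 6 → ZMod 2) : ℝ := if ∑ l ∈ T, y l = 0 then 1 else -1

/-- Real density of the functional. -/
def dens (y : Fin 6 → ZMod 2) : ℝ := 1 + ∑ v : Fin 4, (sgn v : ℝ) * chi (star v) y

/-- The real character is the cast of the integer one. -/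
theorem chi_eq_cast (T : Finset (Fin 6)) (y : Fin 6 → ZMod 2) : chi T y = (chiZ T y : ℝ) := by
  unfold chi chiZ; split_ifs <;> simp

/-- The real density is the cast of the integer one. -/
theorem dens_eq_cast (y : Fin 6 → ZMod 2) : dens y = (densZ y : ℝ) := by
  unfold dens densZ; push_cast; simp [chi_eq_cast]

/-- `Σ_y ẽ(y) = 64` (kernel-decided). -/
theorem sum_densZ : ∑ y : Fin 6 → ZMod 2, densZ y = 64 := by decide

/-- `Σ_y ẽ(y) · viol_{K4}(y) = 0` (kernel-decided on `violN`). -/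
theorem sum_densZ_violN : ∑ y : Fin 6 → ZMod 2, densZ y * (K4Inst.violN y : ℤ) = 0 := by decide

/-- Every star has three edges. -/
theorem card_star (v : Fin 4) : (star v).card = 3 := by fin_cases v <;> decide

/-- The stars are pairwise distinct. -/
theorem star_injective : Function.Injective star := by decide

/-! ### The functional and its four clauses -/

/-- Grigoriev's degree-3 functional for `K4`: `E[h] = 2^{-6} Σ_y ẽ(y) h(y)`. -/
def E : ((Fin 6 → ZMod 2) → ℝ) →ₗ[ℝ] ℝ where
  toFun h := (1 / 64 : ℝ) * ∑ y, dens y * h y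
  map_add' h h' := by
    simp only [Pi.add_apply, mul_add, Finset.sum_add_distrib]
  map_smul' a h := by
    simp only [Pi.smul_apply, smul_eq_mul, RingHom.id_apply, Finset.mul_sum]
    refine Finset.sum_congr rfl fun y _ => ?_
    ring

/-- Unfolding `E`. -/
theorem E_apply (h : (Fin 6 → ZMod 2) → ℝ) : E h = (1 / 64 : ℝ) * ∑ y, dens y * h y := rfl

/-- Normalisation `E[1] = 1`. -/
theorem E_one : E (fun _ => (1 : ℝ)) = 1 := by
  rw [E_apply]
  have : ∑ y : Fin 6 → ZMod 2, dens y * 1 = ((∑ y : Fin 6 → ZMod 2, densZ y : ℤ) : ℝ) := by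
    push_cast; exact Finset.sum_congr rfl fun y _ => by rw [mul_one, dens_eq_cast]
  rw [this, sum_densZ]; norm_num

/-- Perfect completeness `E[viol_{K4}] = 0`. -/
theorem E_viol : E (fun y => (viol K4Inst.K4 y : ℝ)) = 0 := by
  rw [E_apply]
  have : ∑ y : Fin 6 → ZMod 2, dens y * (viol K4Inst.K4 y : ℝ)
      = ((∑ y : Fin 6 → ZMod 2, densZ y * (K4Inst.violN y : ℤ) : ℤ) : ℝ) := by
    push_cast
    exact Finset.sum_congr rfl fun y _ => by rw [dens_eq_cast, K4Inst.viol_K4_eq]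
  rw [this, sum_densZ_violN]; norm_num

/-- Sherali–Adams clause: `E` is non-negative on non-negative `3`-juntas.  A character of a star is
orthogonal to every junta whose support does not contain the star; a support of size `≤ 3` contains at
most one star, and `|Σ χ h| ≤ Σ h`. -/
theorem E_junta_nonneg (h : (Fin 6 → ZMod 2) → ℝ) (hh : IsJunta 3 h) (hpos : ∀ y, 0 ≤ h y) :
    0 ≤ E h := by
  classical
  obtain ⟨S, hS, hhS⟩ := hh
  rw [E_apply]
  refine mul_nonneg (by norm_num) ?_
  -- expand the density
  have hexp : ∑ y, dens y * h y = ∑ y, h y + ∑ v : Fin 4, (sgn v : ℝ) * ∑ y, chi (star v) y * h y := by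
    simp only [dens, add_mul, one_mul, Finset.sum_add_distrib, Finset.sum_mul]
    congr 1
    rw [Finset.sum_comm]
    refine Finset.sum_congr rfl fun v _ => ?_
    rw [Finset.mul_sum]
    refine Finset.sum_congr rfl fun y _ => ?_
    ring
  rw [hexp]
  -- stars not inside `S` contribute nothing
  have hvan : ∀ v : Fin 4, ¬ star v ⊆ S → ∑ y, chi (star v) y * h y = 0 := fun v hv =>
    sum_chi_mul_junta_eq_zero (star v) S hv h hhS
  -- at most one star lies inside `S`
  have hone : ∀ v v' : Fin 4, star v ⊆ S → star v' ⊆ S → v = v' := by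
    intro v v' hv hv'
    have h1 : star v = S := Finset.eq_of_subset_of_card_le hv (by rw [card_star]; exact hS)
    have h2 : star v' = S := Finset.eq_of_subset_of_card_le hv' (by rw [card_star]; exact hS)
    exact star_injective (h1.trans h2.symm)
  -- each character sum is bounded by `Σ h`
  have hbd : ∀ v : Fin 4, |(sgn v : ℝ) * ∑ y, chi (star v) y * h y| ≤ ∑ y, h y := by
    intro v
    have hsgn : |(sgn v : ℝ)| = 1 := by fin_cases v <;> simp [sgn]
    rw [abs_mul, hsgn, one_mul]
    refine (Finset.abs_sum_le_sum_abs _ _).trans (Finset.sum_le_sum fun y _ => ?_)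
    rw [abs_mul]
    have : |chi (star v) y| = 1 := by unfold chi; split_ifs <;> simp
    rw [this, one_mul, abs_of_nonneg (hpos y)]
  have hsum_nonneg : 0 ≤ ∑ y, h y := Finset.sum_nonneg fun y _ => hpos y
  -- the signed sum over `v` has at most one non-zero term
  set I : Finset (Fin 4) := univ.filter fun v => star v ⊆ S with hI
  have hIcard : I.card ≤ 1 := Finset.card_le_one.2 fun v hv v' hv' => by
    simp only [hI, mem_filter, mem_univ, true_and] at hv hv'
    exact hone v v' hv hv'
  have hsplit : ∑ v : Fin 4, (sgn v : ℝ) * ∑ y, chi (star v) y * h y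
      = ∑ v ∈ I, (sgn v : ℝ) * ∑ y, chi (star v) y * h y := by
    rw [hI, Finset.sum_filter]
    refine Finset.sum_congr rfl fun v _ => ?_
    split_ifs with hv
    · rfl
    · rw [hvan v hv, mul_zero]
  rw [hsplit]
  have habs : |∑ v ∈ I, (sgn v : ℝ) * ∑ y, chi (star v) y * h y| ≤ ∑ y, h y := by
    refine (Finset.abs_sum_le_sum_abs _ _).trans ?_
    calc ∑ v ∈ I, |(sgn v : ℝ) * ∑ y, chi (star v) y * h y| ≤ ∑ _v ∈ I, ∑ y, h y :=
          Finset.sum_le_sum fun v _ => hbd v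
      _ = I.card * ∑ y, h y := by rw [Finset.sum_const, nsmul_eq_mul]
      _ ≤ 1 * ∑ y, h y := by
          refine mul_le_mul_of_nonneg_right ?_ hsum_nonneg
          exact_mod_cast hIcard
      _ = ∑ y, h y := one_mul _
  have := neg_abs_le (∑ v ∈ I, (sgn v : ℝ) * ∑ y, chi (star v) y * h y)
  linarith

/-- SOS clause: `E[s²] ≥ 0` for `s` in the span of the `1`-juntas (`3 / 2 = 1`); the characters of the
(three-element) stars are orthogonal to such squares. -/
theorem E_sq_nonneg (s : (Fin 6 → ZMod 2) → ℝ)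
    (hs : s ∈ Submodule.span ℝ {f : (Fin 6 → ZMod 2) → ℝ | IsJunta (3 / 2) f}) : 0 ≤ E (s * s) := by
  classical
  have hs1 : s ∈ Submodule.span ℝ {f : (Fin 6 → ZMod 2) → ℝ | IsJunta 1 f} := hs
  obtain ⟨g, hg, rfl⟩ := exists_decomp_of_mem_span_oneJunta hs1
  rw [E_apply]
  refine mul_nonneg (by norm_num) ?_
  have hexp : ∑ y, dens y * (((∑ i, g i) * ∑ i, g i) : (Fin 6 → ZMod 2) → ℝ) y
      = ∑ y, ((∑ i, g i y) * ∑ i, g i y)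
        + ∑ v : Fin 4, (sgn v : ℝ) * ∑ y, chi (star v) y * ((∑ i, g i y) * ∑ i, g i y) := by
    simp only [dens, Pi.mul_apply, Finset.sum_apply, add_mul, one_mul, Finset.sum_add_distrib,
      Finset.sum_mul]
    congr 1
    rw [Finset.sum_comm]
    refine Finset.sum_congr rfl fun v _ => ?_
    rw [Finset.mul_sum]
    refine Finset.sum_congr rfl fun y _ => ?_
    ring
  rw [hexp]
  have hvan : ∀ v : Fin 4, ∑ y, chi (star v) y * ((∑ i, g i y) * ∑ i, g i y) = 0 := fun v =>
    sum_chi_mul_sq_eq_zero (star v) (by rw [card_star]) g hg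
  simp only [hvan, mul_zero, Finset.sum_const_zero, add_zero]
  exact Finset.sum_nonneg fun y _ => mul_self_nonneg _

/-- **`K4` carries a degree-3 perfect-completeness SA+SOS pseudo-expectation.** -/
theorem hasPerfectPseudoExp : HasPerfectPseudoExp 3 K4Inst.K4 :=
  ⟨E, E_junta_nonneg, E_sq_nonneg, E_one, E_viol⟩

end K4PE

/-- `K4` is an explicit witness of `PerfectCompleteness` at degree `3` (unsatisfiable and degree-3 fooled). -/
theorem k4_perfectCompleteness_three :
    (¬ ∃ y : Fin 6 → ZMod 2, ∀ e ∈ K4Inst.K4, Sat y e) ∧ HasPerfectPseudoExp 3 K4Inst.K4 :=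
  ⟨K4Inst.k4_unsat, K4PE.hasPerfectPseudoExp⟩

/-! ## §3 The degree-5 Sherali–Adams value of `K4`, the unit-level upper bound, calibration -/

/-- The first 5-junta of the identity: `[s₁ = 1][s₂ = 1]` (vertex parities 1 and 2 both bad). -/
def j₁ (y : Fin 6 → ZMod 2) : ℝ := if y 0 + y 1 + y 2 = 0 ∧ y 0 + y 3 + y 4 = 1 then 1 else 0

/-- The second 5-junta: `[s₃ = 1][s₁ ≠ s₂]`. -/
def j₂ (y : Fin 6 → ZMod 2) : ℝ :=
  if y 1 + y 3 + y 5 = 1 ∧ y 1 + y 2 + y 3 + y 4 = 0 then 1 else 0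

/-- The degree-5 identity `viol_{K4} = 1 + 2 j₁ + 2 j₂` (kernel-decided on the 64 points). -/
theorem violN_eq (y : Fin 6 → ZMod 2) : (K4Inst.violN y : ℝ) = 1 + 2 * j₁ y + 2 * j₂ y := by
  have key : ∀ a0 a1 a2 a3 a4 a5 : ZMod 2,
      K4Inst.violN ![a0, a1, a2, a3, a4, a5]
        = 1 + 2 * (if a0 + a1 + a2 = 0 ∧ a0 + a3 + a4 = 1 then 1 else 0)
            + 2 * (if a1 + a3 + a5 = 1 ∧ a1 + a2 + a3 + a4 = 0 then 1 else 0) := by decide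
  have hy : y = ![y 0, y 1, y 2, y 3, y 4, y 5] := by funext k; fin_cases k <;> rfl
  have h := key (y 0) (y 1) (y 2) (y 3) (y 4) (y 5)
  rw [← hy] at h
  unfold j₁ j₂
  rw [h]; push_cast; split_ifs <;> norm_num

/-- `j₁` is a non-negative `5`-junta (edges `0,1,2,3,4`). -/
theorem j₁_junta : IsJunta 5 j₁ ∧ ∀ y, 0 ≤ j₁ y := by
  refine ⟨⟨{0, 1, 2, 3, 4}, by decide, fun y y' h => ?_⟩, fun y => by unfold j₁; split_ifs <;> norm_num⟩
  simp only [j₁, h 0 (by decide), h 1 (by decide), h 2 (by decide), h 3 (by decide), h 4 (by decide)]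

/-- `j₂` is a non-negative `5`-junta (edges `1,2,3,4,5`). -/
theorem j₂_junta : IsJunta 5 j₂ ∧ ∀ y, 0 ≤ j₂ y := by
  refine ⟨⟨{1, 2, 3, 4, 5}, by decide, fun y y' h => ?_⟩, fun y => by unfold j₂; split_ifs <;> norm_num⟩
  simp only [j₂, h 1 (by decide), h 2 (by decide), h 3 (by decide), h 4 (by decide), h 5 (by decide)]

/-- **The degree-5 Sherali–Adams value of `K4` is `1`:** every linear functional non-negative on
non-negative `5`-juntas with `E[1] = 1` has `E[viol_{K4}] ≥ 1`. -/
theorem k4_sa_five (E : ((Fin 6 → ZMod 2) → ℝ) →ₗ[ℝ] ℝ)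
    (hE : ∀ h : (Fin 6 → ZMod 2) → ℝ, IsJunta 5 h → (∀ x, 0 ≤ h x) → 0 ≤ E h)
    (hE1 : E (fun _ => 1) = 1) : 1 ≤ E (fun y => (viol K4Inst.K4 y : ℝ)) := by
  have hfun : (fun y => (viol K4Inst.K4 y : ℝ)) = (fun _ => (1 : ℝ)) + (2 : ℝ) • j₁ + (2 : ℝ) • j₂ := by
    funext y
    simp only [Pi.add_apply, Pi.smul_apply, smul_eq_mul, K4Inst.viol_K4_eq, violN_eq]
  rw [hfun, map_add, map_add, map_smul, map_smul, hE1, smul_eq_mul, smul_eq_mul]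
  have h1 := hE j₁ j₁_junta.1 j₁_junta.2
  have h2 := hE j₂ j₂_junta.1 j₂_junta.2
  linarith

/-- **Unit level of K₄, upper side:** for every `t ≥ 1` the unit-potential level `lift_t(viol_{K4}) − J`
has a non-negative factorisation with `r ≤ #{S ⊆ [6] : #S ≤ 5} · (2t)⁵` terms (c1's lifting of the
degree-5 conic-junta certificate). -/
theorem k4_unitLevel_upper {t : ℕ} (ht : 1 ≤ t) :
    ∃ r : ℕ, r ≤ Fintype.card {S : Finset (Fin 6) // S.card ≤ 5} * (2 * t) ^ 5 ∧
      HasConeFact (fun (x : Fin 6 → Fin t → ZMod 2) (w : Fin 6 → Fin t) =>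
        (viol K4Inst.K4 (fun i => x i (w i)) : ℝ) - 1) 0 r :=
  hasConeFact_shift_of_saValue (by norm_num) ht K4Inst.K4 (ε := 1) fun E hE hE1 => k4_sa_five E hE hE1

/-- **Registered sub-goal `exactLifting_phi_three_le_five` of stmt-PneNP-10680.** Calibration of the
stub at its minimal degree: every exponent function of `ExactLifting` has `φ(3) ≤ 5` (the K₄ instance is
unsatisfiable, degree-3 fooled, and has degree-5 Sherali–Adams value `1`; c1's
`exactLifting_exponent_le`). -/
theorem exactLifting_phi_three_le_five : ExactLifting →
    ∃ φ : ℕ → ℕ, (∀ K : ℕ, ∃ d : ℕ, K ≤ φ d) ∧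
      (∀ (m d : ℕ) (F : Finset (Pool m)),
        (¬ ∃ y : Fin m → ZMod 2, ∀ e ∈ F, Sat y e) → HasPerfectPseudoExp d F →
        ∃ T : ℕ, ∀ (t : ℕ) (ε : ℝ), T ≤ t → 0 < ε → ∀ q r : ℕ,
          HasConeFact (fun (x : Fin m → Fin t → ZMod 2) (w : Fin m → Fin t) =>
            (viol F (fun i => x i (w i)) : ℝ) - ε) q r → t ^ φ d ≤ q + r) ∧
      φ 3 ≤ 5 := by
  rintro ⟨φ, hφu, hφ⟩
  refine ⟨φ, hφu, hφ, ?_⟩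
  exact exactLifting_exponent_le φ hφ (by norm_num) K4Inst.K4 K4Inst.k4_unsat
    K4PE.hasPerfectPseudoExp one_pos fun E hE hE1 => k4_sa_five E hE hE1

end

end Summit.PneNP.PneNP.Theorems.XorDoor
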